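import Summits.BirchSwinnertonDyer.BirchSwinnertonDyer.Theorems.KimAtThreeKolyvaginIsogenyInvariance
import Literature.NumberTheory.EllipticCurves.KummerMap
import Literature.NumberTheory.EllipticCurves.LocalKummerIsotropyTransport
import Literature.NumberTheory.EllipticCurves.KummerSelmerStructure
import Literature.NumberTheory.EllipticCurves.ShaPrimaryIsogenyProofs
import Literature.NumberTheory.EllipticCurves.ComplexMultiplicationShaIsogenyProofs
import HarnessLib

/-!
# Route `KimAtThreeKolyvagin` (rung W2): TRANSPORT of the crux binders along a `ℚ`-isogeny
# (tower surjectivity, irreducibility, `#Ш[p^∞]`, finiteness of `Ш`, the local torsion `#E(ℚ_p)[p]`)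

Cell `bsd-addord`, seat `bsd-addord-kim3` (gen 9). TOOL FILE: theorems only (no definition, no named
fact, no `sorry`); it closes nothing and books nothing. Companion of
`KimAtThreeKolyvaginIsogenyInvariance` (the `∂`-functionals are isogeny invariants); consumed by
`KimAtThreeKolyvaginIsogenyCruxes` (the three W2 cruxes ⟸ their restriction to OPTIMAL parametrised
curves). Everything here is the bookkeeping of one fact: out of a curve with `E[p]` irreducible every
`ℚ`-isogeny class mate is reached by an isogeny of degree prime to `p` (*AEC* III.4.11; tree
`SkinnerUrban2014.exists_isogeny_not_dvd_degree_of_irreducible`), which restricts to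
`Γ_ℚ`-equivariant isomorphisms `E[p^j] ≅ E'[p^j]` (`exists_torsionAddEquiv_of_coprime`). Hence, for
`ℚ`-isogenous elliptic `W ~ W'` with `E[p]` irreducible:

* `hasIrreducibleModPGaloisRep_of_torsionAddEquiv`, `hasSurjectiveModNGaloisRep_iff_of_torsionAddEquiv`
  — image conditions move along an equivariant `E[n] ≅ E'[n]`; `towerSurjective_of_isIsogenous` —
  the `p`-adic tower `ρ_{E,p^j}` is onto for all `j` iff it is for `W'`;
* `natCard_primaryComponent_sha_eq_of_isIsogenous` — `#Ш(W)[p^∞] = #Ш(W')[p^∞]` (Milne ADT I.7.1(b),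
  tree `Isogeny.natCard_primaryComponent_sha_eq`); `finite_sha_iff_of_isIsogenous` (tree
  `shaFinite_iff_of_isIsogenous_holds`);
* `natCard_torsion_padic_le_of_isogeny` / `natCard_torsion_padic_eq_of_isIsogenous` —
  `#E(ℚ_p)[p] = #E'(ℚ_p)[p]` (the `t`-parameter of crux `ShallowEqDeepAtTorsionFree`): the base change
  `φ_{ℚ_p}` of a prime-to-`p` isogeny (tree `Isogeny.localPointsMap`) is injective on the `p`-torsion
  of `E(ℚ̄_p)` — all of which is algebraic (tree `torsionPointsEquiv`, *AEC* III.6.4(b)) — and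
  `Γ_{ℚ_p}`-equivariant, so it injects `E(ℚ_p)[p]` into `E'(ℚ_p)[p]` (Galois descent over the
  perfect field `ℚ_p`, tree `mem_range_toGeomPoints_iff` + `baseChangeGeomPointsEquiv`).

References: J. H. Silverman, *AEC* 2nd ed. (2009), III.4.11, III.6.4(b), VIII.§1 [SilvermanAEC2009];
J. S. Milne, *Arithmetic Duality Theorems* (2006), Lemma I.7.1(b) [MilneADT2006]; cell memo
`run/shared/lean/pub/bsd-addord/kim3/KIM3-PROOF.md` §1, §17.
-/

-- the Theorems namespace of a single-conjunct summit repeats the summit name by design (D-0017)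
set_option linter.dupNamespace false

noncomputable section

open scoped Classical NumberField MatrixGroups ModularForm
open Function Field WeierstrassCurve CongruenceSubgroup
open Literature.NumberTheory.EllipticCurves
open Summit.BirchSwinnertonDyer.BirchSwinnertonDyer.Theorems.KimAtThreeKolyvaginIsogenyInvariance

namespace Summit.BirchSwinnertonDyer.BirchSwinnertonDyer.Theorems.KimAtThreeKolyvaginIsogenyTransport

/-! ### §1 Image conditions along an equivariant `E[n] ≅ E'[n]`; the `p`-adic tower -/

section Image

variable {W W' : WeierstrassCurve ℚ} [W.IsElliptic] [W'.IsElliptic]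

omit [W.IsElliptic] [W'.IsElliptic] in
/-- Irreducibility of `E[p]` moves along a `Γ_ℚ`-equivariant isomorphism `E[p] ≅ E'[p]`: stable
subgroups correspond under `e`. [folklore] -/
theorem hasIrreducibleModPGaloisRep_of_torsionAddEquiv {p : ℕ}
    (e : geomTorsion W (p : ℤ) ≃+ geomTorsion W' (p : ℤ))
    (he : ∀ (σ : absoluteGaloisGroup ℚ) (P : geomTorsion W (p : ℤ)), e (σ • P) = σ • e P)
    (h : W.HasIrreducibleModPGaloisRep p) : W'.HasIrreducibleModPGaloisRep p := by
  intro H hH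
  let H₀ : AddSubgroup (geomTorsion W (p : ℤ)) := H.comap e.toAddMonoidHom
  have hmem : ∀ P : geomTorsion W (p : ℤ), P ∈ H₀ ↔ e P ∈ H := fun P => AddSubgroup.mem_comap
  have hH₀ : ∀ σ : absoluteGaloisGroup ℚ, ∀ P ∈ H₀, σ • P ∈ H₀ := fun σ P hP => by
    rw [hmem] at hP ⊢
    rw [he]
    exact hH σ _ hP
  rcases h H₀ hH₀ with hbot | htop
  · left
    refine (AddSubgroup.eq_bot_iff_forall H).mpr fun Q hQ => ?_
    have hQ' : e.symm Q ∈ H₀ := by rw [hmem, e.apply_symm_apply]; exact hQ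
    rw [hbot, AddSubgroup.mem_bot] at hQ'
    rw [← e.apply_symm_apply Q, hQ', map_zero]
  · right
    refine (AddSubgroup.eq_top_iff' H).mpr fun Q => ?_
    have hQ' : e.symm Q ∈ H₀ := by rw [htop]; exact AddSubgroup.mem_top _
    rw [hmem, e.apply_symm_apply] at hQ'
    exact hQ'

omit [W.IsElliptic] [W'.IsElliptic] in
/-- Surjectivity of `ρ̄_{E,n}` moves along a `Γ_ℚ`-equivariant isomorphism `ε : E[n] ≅ E'[n]`
(conjugation by `ε` identifies `Aut E[n]` with `Aut E'[n]` compatibly with the two representations) —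
one direction. [folklore] -/
theorem hasSurjectiveModNGaloisRep_of_torsionAddEquiv {n : ℤ}
    (ε : geomTorsion W n ≃+ geomTorsion W' n)
    (hε : ∀ (σ : absoluteGaloisGroup ℚ) (P : geomTorsion W n), ε (σ • P) = σ • ε P)
    (h : W'.HasSurjectiveModNGaloisRep n) : W.HasSurjectiveModNGaloisRep n := by
  intro g
  set g' : AddAut (geomTorsion W' n) := ε.symm.trans ((Multiplicative.toAdd g).trans ε) with hg'
  obtain ⟨σ, hσ⟩ := h (Multiplicative.ofAdd g')
  refine ⟨σ, ?_⟩
  apply Multiplicative.toAdd.injective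
  refine AddEquiv.ext fun P ↦ ε.injective ?_
  have h1 : Multiplicative.toAdd (galoisRepTorsion W' n σ) (ε P) = σ • ε P := rfl
  have h2 : Multiplicative.toAdd (galoisRepTorsion W n σ) P = σ • P := rfl
  rw [h2, hε, ← h1, hσ, toAdd_ofAdd, hg', AddEquiv.trans_apply, AddEquiv.trans_apply,
    AddEquiv.symm_apply_apply]

omit [W.IsElliptic] [W'.IsElliptic] in
/-- Surjectivity of `ρ̄_{E,n}` is invariant along a `Γ_ℚ`-equivariant `E[n] ≅ E'[n]`. [folklore] -/
theorem hasSurjectiveModNGaloisRep_iff_of_torsionAddEquiv {n : ℤ}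
    (ε : geomTorsion W n ≃+ geomTorsion W' n)
    (hε : ∀ (σ : absoluteGaloisGroup ℚ) (P : geomTorsion W n), ε (σ • P) = σ • ε P) :
    W.HasSurjectiveModNGaloisRep n ↔ W'.HasSurjectiveModNGaloisRep n := by
  have hε' : ∀ (σ : absoluteGaloisGroup ℚ) (Q : geomTorsion W' n), ε.symm (σ • Q) = σ • ε.symm Q :=
    fun σ Q => ε.injective (by rw [hε, ε.apply_symm_apply, ε.apply_symm_apply])
  exact ⟨hasSurjectiveModNGaloisRep_of_torsionAddEquiv ε.symm hε',
    hasSurjectiveModNGaloisRep_of_torsionAddEquiv ε hε⟩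

/-- Surjectivity mod `p` gives irreducibility of `E[p]` (over `ℚ`, `p` prime). [folklore] -/
theorem hasIrreducibleModPGaloisRep_of_surjective {p : ℕ} [Fact p.Prime]
    (h : W.HasSurjectiveModNGaloisRep (p : ℤ)) : W.HasIrreducibleModPGaloisRep p := by
  haveI : NeZero (p : ℚ) := ⟨Nat.cast_ne_zero.mpr (Fact.out : p.Prime).ne_zero⟩
  exact hasIrreducibleModPGaloisRep_of_hasSurjectiveModNGaloisRep W p h

/-- The tower hypothesis of the W2 cruxes gives irreducibility of `E[p]` (its `j = 1` instance).
[folklore] -/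
theorem hasIrreducibleModPGaloisRep_of_tower {p : ℕ} [Fact p.Prime]
    (h : ∀ j : ℕ, W.HasSurjectiveModNGaloisRep (p ^ j : ℕ)) : W.HasIrreducibleModPGaloisRep p := by
  have h1 := h 1
  rw [pow_one] at h1
  exact hasIrreducibleModPGaloisRep_of_surjective h1

/-- **The `p`-adic tower condition is a `ℚ`-isogeny invariant**: if `ρ_{E,p^j}` is onto for every
`j`, then so is `ρ_{E',p^j}` for every `ℚ`-isogenous `E'` (a prime-to-`p` isogeny identifies
`E[p^j]` with `E'[p^j]` equivariantly). [cite: SilvermanAEC2009, Cor. III.4.11] -/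
theorem towerSurjective_of_isIsogenous {p : ℕ} [Fact p.Prime] (hiso : IsIsogenous W W')
    (h : ∀ j : ℕ, W.HasSurjectiveModNGaloisRep (p ^ j : ℕ)) (j : ℕ) :
    W'.HasSurjectiveModNGaloisRep (p ^ j : ℕ) := by
  obtain ⟨e, he⟩ := exists_torsionAddEquiv_pow_of_irreducible (hasIrreducibleModPGaloisRep_of_tower h)
    hiso j
  exact (hasSurjectiveModNGaloisRep_iff_of_torsionAddEquiv e he).mp (h j)

/-- Irreducibility of `E[p]` is a `ℚ`-isogeny invariant. [cite: SilvermanAEC2009, Cor. III.4.11] -/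
theorem hasIrreducibleModPGaloisRep_of_isIsogenous {p : ℕ} [Fact p.Prime] (hiso : IsIsogenous W W')
    (h : W.HasIrreducibleModPGaloisRep p) : W'.HasIrreducibleModPGaloisRep p := by
  obtain ⟨e, he⟩ := exists_torsionAddEquiv_of_irreducible h hiso
  exact hasIrreducibleModPGaloisRep_of_torsionAddEquiv e he h

end Image

/-! ### §2 `Ш`: the `p`-primary part and finiteness -/

section Sha

variable {W W' : WeierstrassCurve ℚ} [W.IsElliptic] [W'.IsElliptic]

/-- **`#Ш(E/ℚ)[p^∞] = #Ш(E'/ℚ)[p^∞]` for `ℚ`-isogenous curves with `E[p]` irreducible** (along a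
prime-to-`p` isogeny, Milne ADT I.7.1(b) — tree `Isogeny.natCard_primaryComponent_sha_eq`).
[cite: MilneADT2006, Ch. I Lemma 7.1(b) (proof), p. 96] -/
theorem natCard_primaryComponent_sha_eq_of_isIsogenous {p : ℕ} [Fact p.Prime]
    (hiso : IsIsogenous W W') (hirr : W.HasIrreducibleModPGaloisRep p) :
    Nat.card (AddCommGroup.primaryComponent W.sha p) =
      Nat.card (AddCommGroup.primaryComponent W'.sha p) := by
  obtain ⟨ψ, hψ⟩ := SkinnerUrban2014.exists_isogeny_not_dvd_degree_of_irreducible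
    (W := W) (W' := W') (Nat.cast_ne_zero.mpr (Fact.out : p.Prime).ne_zero) hirr hiso
  exact ψ.natCard_primaryComponent_sha_eq p hψ

/-- Finiteness of `Ш` is a `ℚ`-isogeny invariant (Milne ADT I.7.1(b); tree
`shaFinite_iff_of_isIsogenous_holds`). [cite: MilneADT2006, Ch. I Lemma 7.1(b), p. 96] -/
theorem finite_sha_iff_of_isIsogenous (hiso : IsIsogenous W W') : Finite W.sha ↔ Finite W'.sha :=
  shaFinite_iff_of_isIsogenous_holds ℚ W W' hiso

end Sha

/-! ### §3 The local torsion count `#E(ℚ_p)[p]` -/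

section LocalTorsion

variable {W W' : WeierstrassCurve ℚ} [W.IsElliptic] [W'.IsElliptic] {p : ℕ} [Fact p.Prime]

/-- **`#E(ℚ_p)[p] ≤ #E'(ℚ_p)[p]` along an isogeny `φ : E → E'` of degree prime to `p`.** The base
change `φ_{ℚ_p}` (tree `Isogeny.localPointsMap`) is `Γ_{ℚ_p}`-equivariant and injective on the
`p`-torsion of `E(ℚ̄_p)`, all of which comes from `E[p](ℚ̄)` (*AEC* III.6.4(b), tree
`torsionPointsEquiv`), on which `φ` is injective; by Galois descent over the perfect field `ℚ_p`
(tree `mem_range_toGeomPoints_iff`, `baseChangeGeomPointsEquiv`) it therefore injects `E(ℚ_p)[p]`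
into `E'(ℚ_p)[p]`. [cite: SilvermanAEC2009, Cor. III.6.4(b) and VIII.§1] -/
theorem natCard_torsion_padic_le_of_isogeny (φ : Isogeny W W') (hφ : ¬ p ∣ φ.degree) :
    Nat.card {Q : (W.baseChange ℚ_[p]).toAffine.Point // p • Q = 0} ≤
      Nat.card {Q : (W'.baseChange ℚ_[p]).toAffine.Point // p • Q = 0} := by
  have hp : p.Prime := Fact.out
  have hp0 : (p : ℤ) ≠ 0 := by exact_mod_cast hp.ne_zero
  -- the inclusions `E(ℚ_p) → E(ℚ̄_p)`: injective, with `Γ_{ℚ_p}`-fixed image, and Galois descent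
  set ι : (W.baseChange ℚ_[p]).toAffine.Point →+ localPoints W ℚ_[p] :=
    (W.baseChangeGeomPointsEquiv ℚ_[p]).toAddMonoidHom.comp (toGeomPoints (W.baseChange ℚ_[p]))
    with hι
  set ι' : (W'.baseChange ℚ_[p]).toAffine.Point →+ localPoints W' ℚ_[p] :=
    (W'.baseChangeGeomPointsEquiv ℚ_[p]).toAddMonoidHom.comp (toGeomPoints (W'.baseChange ℚ_[p]))
    with hι'
  have hιinj : Injective ι :=
    (W.baseChangeGeomPointsEquiv ℚ_[p]).injective.comp (toGeomPoints_injective _)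
  have hι'inj : Injective ι' :=
    (W'.baseChangeGeomPointsEquiv ℚ_[p]).injective.comp (toGeomPoints_injective _)
  have hfix : ∀ (τ : absoluteGaloisGroup ℚ_[p]) (R : (W.baseChange ℚ_[p]).toAffine.Point),
      τ • ι R = ι R := fun τ R => by
    change τ • W.baseChangeGeomPointsEquiv ℚ_[p] (toGeomPoints (W.baseChange ℚ_[p]) R) =
      W.baseChangeGeomPointsEquiv ℚ_[p] (toGeomPoints (W.baseChange ℚ_[p]) R)
    rw [← baseChangeGeomPointsEquiv_smul, smul_toGeomPoints]
  have hdesc' : ∀ X : localPoints W' ℚ_[p], (∀ τ : absoluteGaloisGroup ℚ_[p], τ • X = X) →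
      ∃ R : (W'.baseChange ℚ_[p]).toAffine.Point, ι' R = X := fun X hX => by
    have hX' : (W'.baseChangeGeomPointsEquiv ℚ_[p]).symm X ∈
        MulAction.fixedPoints (absoluteGaloisGroup ℚ_[p]) (geomPoints (W'.baseChange ℚ_[p])) := by
      intro τ
      apply (W'.baseChangeGeomPointsEquiv ℚ_[p]).injective
      rw [baseChangeGeomPointsEquiv_smul, AddEquiv.apply_symm_apply, hX τ]
    obtain ⟨R, hR⟩ := ((W'.baseChange ℚ_[p]).mem_range_toGeomPoints_iff _).mpr hX'
    refine ⟨R, ?_⟩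
    change W'.baseChangeGeomPointsEquiv ℚ_[p] (toGeomPoints (W'.baseChange ℚ_[p]) R) = X
    rw [hR, AddEquiv.apply_symm_apply]
  -- the local map of `φ` and its injectivity on `p`-torsion (all of which is algebraic)
  set Φ := φ.localPointsMap ℚ_[p] with hΦ
  obtain ⟨e, -, he⟩ := exists_torsionAddEquiv_of_coprime φ hp.ne_zero
    ((Nat.Prime.coprime_iff_not_dvd hp).mpr hφ).symm
  have hΦinj : ∀ X : localPoints W ℚ_[p], (p : ℤ) • X = 0 → Φ X = 0 → X = 0 := by
    intro X hX hΦX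
    set P₀ : geomTorsion W (p : ℤ) := (W.torsionPointsEquiv (p : ℤ) (E := ℚ_[p]) hp0).symm
      ⟨X, (Submodule.mem_torsionBy_iff _ _).mpr hX⟩ with hP₀
    have hX' : pointsMap W ℚ_[p] (P₀ : W.geomPoints) = X := by
      rw [hP₀, pointsMap_torsionPointsEquiv_symm]
    have h1 : pointsMap W' ℚ_[p] (φ P₀) = 0 := by
      rw [← φ.localPointsMap_pointsMap ℚ_[p], hX']
      exact hΦX
    have h2 : φ (P₀ : W.geomPoints) = 0 :=
      pointsMapOfEmb_injective W' (closureEmb (K := ℚ) ℚ_[p]) (by rw [map_zero]; exact h1)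
    have h3 : P₀ = 0 := by
      apply e.injective
      rw [map_zero]
      exact Subtype.ext (by rw [he P₀, h2]; rfl)
    rw [← hX', h3, ZeroMemClass.coe_zero, map_zero]
  -- the transported point: `Φ (ι Q)` is `Γ_{ℚ_p}`-fixed, hence rational
  have hdesc : ∀ Q : (W.baseChange ℚ_[p]).toAffine.Point, ∃ R : (W'.baseChange ℚ_[p]).toAffine.Point,
      ι' R = Φ (ι Q) := fun Q =>
    hdesc' _ fun τ => by rw [hΦ, ← φ.localPointsMap_smul ℚ_[p], hfix]
  choose g hg using hdesc
  -- finiteness of the target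
  haveI : Finite (AddSubgroup.torsionBy (localPoints W' ℚ_[p]) (p : ℤ)) :=
    finite_torsionPoints_holds W' (AlgebraicClosure ℚ_[p]) hp0
  haveI : Finite {Q : (W'.baseChange ℚ_[p]).toAffine.Point // p • Q = 0} := by
    refine Finite.of_injective (fun Q => (⟨ι' Q.1, (Submodule.mem_torsionBy_iff _ _).mpr ?_⟩ :
      AddSubgroup.torsionBy (localPoints W' ℚ_[p]) (p : ℤ))) fun Q₁ Q₂ h => ?_
    · rw [natCast_zsmul, ← map_nsmul, Q.2, map_zero]
    · exact Subtype.ext (hι'inj (congrArg Subtype.val h))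
  -- the injection
  refine Nat.card_le_card_of_injective (fun Q => (⟨g Q.1, ?_⟩ :
    {Q : (W'.baseChange ℚ_[p]).toAffine.Point // p • Q = 0})) fun Q₁ Q₂ h => ?_
  · apply hι'inj
    rw [map_nsmul, hg, ← map_nsmul, ← map_nsmul, Q.2, map_zero, map_zero, map_zero]
  · have hR : g Q₁.1 = g Q₂.1 := congrArg Subtype.val h
    have hX : Φ (ι Q₁.1) = Φ (ι Q₂.1) := by rw [← hg, ← hg, hR]
    have hsub : ι (Q₁.1 - Q₂.1) = 0 := by
      refine hΦinj _ ?_ ?_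
      · rw [natCast_zsmul, ← map_nsmul, nsmul_sub, Q₁.2, Q₂.2, sub_self, map_zero]
      · rw [map_sub, map_sub, hX, sub_self]
    exact Subtype.ext (sub_eq_zero.mp (hιinj (by rw [hsub, map_zero])))

/-- **`#E(ℚ_p)[p] = #E'(ℚ_p)[p]` for `ℚ`-isogenous curves with `E[p]` irreducible** (the
`t`-parameter `t = v_p #E(ℚ_p)[p]` of the W2 cruxes is an isogeny-class invariant): prime-to-`p`
isogenies in both directions. [cite: SilvermanAEC2009, Cor. III.4.11, Cor. III.6.4(b), VIII.§1] -/
theorem natCard_torsion_padic_eq_of_isIsogenous (hiso : IsIsogenous W W')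
    (hirr : W.HasIrreducibleModPGaloisRep p) :
    Nat.card {Q : (W.baseChange ℚ_[p]).toAffine.Point // p • Q = 0} =
      Nat.card {Q : (W'.baseChange ℚ_[p]).toAffine.Point // p • Q = 0} := by
  have hpQ : (p : ℚ) ≠ 0 := Nat.cast_ne_zero.mpr (Fact.out : p.Prime).ne_zero
  obtain ⟨ψ, hψ⟩ := SkinnerUrban2014.exists_isogeny_not_dvd_degree_of_irreducible
    (W := W) (W' := W') hpQ hirr hiso
  obtain ⟨ψ', hψ'⟩ := SkinnerUrban2014.exists_isogeny_not_dvd_degree_of_irreducible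
    (W := W') (W' := W) hpQ (hasIrreducibleModPGaloisRep_of_isIsogenous hiso hirr)
    hiso.symm_of_charZero
  exact le_antisymm (natCard_torsion_padic_le_of_isogeny ψ hψ)
    (natCard_torsion_padic_le_of_isogeny ψ' hψ')

end LocalTorsion

end Summit.BirchSwinnertonDyer.BirchSwinnertonDyer.Theorems.KimAtThreeKolyvaginIsogenyTransport

end
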